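import Literature.NumberTheory.Automorphic.VarmaLocalGlobalPrecI
import Summits.Langlands.Langlands.Theorems.IrreducibilityBySelfDualityReciprocityUpToIrreducibilityAboveUnramified
import Summits.Langlands.Langlands.Theorems.IrreducibilityBySelfDualityIrreducibleOffSectorWDIrreducibleBasics
import Summits.Langlands.Langlands.Theorems.IrreducibilityBySelfDualityIrreducibleOffSectorA1IrreducibleWD
import Summits.Langlands.Langlands.Theorems.IrreducibilityBySelfDualityIrreducibleOffSectorL2TraceRigidity
import Summits.Langlands.Langlands.Theorems.IrreducibilityBySelfDualityIrreducibleOffSectorL3TransportDescent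
import HarnessLib

/-!
# Region A-sc: an attached Galois representation is irreducible at a SUPERCUSPIDAL place away from `ℓ`
(crux stmt-Langlands-14329 `IrreducibilityBySelfDuality.IrreducibleOffSector`, supports kit
`square-integrable-place` §2 `region_supercuspidalPlace`; `--supports` file, lead a1)

For a family `𝓛 = (𝓛_v)_v` of local Langlands data of the completions of `K` satisfying
(V) Varma 2024 Thm 1–2 (the body of the accepted named fact
`Literature.NumberTheory.Automorphic.Varma2024.theorem12_trace_eq_and_precI` with its witness `𝓛`
exposed: equal Weil-group traces of `ι(WD(r|_{Γ_{K_v}}))` and of any Frobenius-semisimple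
representative `S` of `rec_v(π_v ⊗ |det|^{(1-n)/2})`) and
(D) the supercuspidal dictionary clause of Harris–Taylor Thm A for the same `𝓛`
(`rec_v` of a supercuspidal is irreducible), and given
(GD) the existence half of the Grothendieck–Deligne dictionary (`WD(ρ|_{Γ_{K_v}})` exists for `v ∤ ℓ`),
every semisimple `r : Γ_K → GL_n(ℚ̄_ℓ)` attached to a regular algebraic cuspidal `π'`
(C-normalised Satake–Frobenius compatibility at every unramified `v ∤ ℓ`) is IRREDUCIBLE as soon as
`π'` has a supercuspidal local component at some `v ∤ ℓ`:
`S` irreducible (D) ⇒ `Wℂ = ι(W)` irreducible (L2, traces from (V)) ⇒ `W` irreducible (L3) ⇒ `r`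
irreducible (A1-irr).  All hypotheses are stated inline (their kit names `VarmaFor`,
`RecSupercuspidalIrreducible`, `ExistsWeilDeligneOfLadic`, `IsAttached`, `HasSupercuspidalPlaceAwayFrom`
live in the Cruxes kit file and are definitional abbreviations of these texts).
References: Varma, FMS 2024, Thm 1; Harris–Taylor 2001, Thm A; Taylor–Yoshida 2007, Cor 1.3;
Tate, Corvallis 1979, (4.2.1).
-/

noncomputable section

set_option linter.dupNamespace false

open scoped MatrixGroups Matrix NumberField
open Module IsDedekindDomain NumberField
open Literature.NumberTheory.Automorphic Literature.NumberTheory.GaloisRepresentations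

namespace Summit.Langlands.Langlands.Theorems.IrreducibleOffSector.SquareIntegrablePlace

/-- **Region A-sc (supercuspidal place away from `ℓ`) — every `ι`.** Given the family `𝓛` with
Varma's theorem (V) and the supercuspidal dictionary clause (D), and the Grothendieck–Deligne
existence (GD): a semisimple `r` attached to the regular algebraic cuspidal `π'` is irreducible if
`π'_v` is supercuspidal for some `v ∤ ℓ`. [cite: VarmaFMS2024, Thm. 1] [cite: HarrisTaylorAMS2001, Thm. A]
[cite: TaylorYoshida2007, Cor. 1.3] -/
theorem region_supercuspidalPlace {K : Type} [Field K] [NumberField K]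
    (𝓛 : ∀ v : HeightOneSpectrum (𝓞 K), LocalLanglandsDatum (v.adicCompletion K))
    (hV : ∀ {n : ℕ} (hcpt : isCompact_glFiniteIntegralLevel n K)
      (π : CuspidalAutomorphicRepData n K hcpt),
      π.1.IsRegularAlgebraic → ∀ (ℓ : ℕ) [Fact ℓ.Prime] (ι : PadicAlgCl ℓ ≃+* ℂ)
      (r : FramedGaloisRep K (PadicAlgCl ℓ) n),
      r.toGaloisRep.IsSemisimple → HarrisLanTaylorThorne2016.IsCompatible π.1 ι r →
      ∀ (v : HeightOneSpectrum (𝓞 K)), ((ℓ : ℕ) : 𝓞 K) ∉ v.asIdeal →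
      ∀ (πv : SmoothIrrep (GL (Fin n) (v.adicCompletion K))), π.1.HasLocalComponentAt v πv.ρ →
      ∀ (W : WeilDeligneRep (v.adicCompletion K) (PadicAlgCl ℓ) (Fin n → PadicAlgCl ℓ))
        (Wℂ : WeilDeligneRep (v.adicCompletion K) ℂ (Fin n → ℂ)),
        IsWeilDeligneOfLadic (r.toLocal v).toWeilGroupHom W →
        W.IsTransportAlong (ι : PadicAlgCl ℓ →+* ℂ) Wℂ →
      ∀ (S : WeilDeligneRep (v.adicCompletion K) ℂ (Fin n → ℂ)) (hS : S.IsFrobSemisimple),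
        Quotient.mk (frobSemisimpleWDSetoid (v.adicCompletion K) n) ⟨S, hS⟩ =
          (𝓛 v).recTwist ((1 - (n : ℂ)) / 2) πv →
      (∀ w : WeilGroup (v.adicCompletion K),
          LinearMap.trace ℂ (Fin n → ℂ) (Wℂ.ρ w) = LinearMap.trace ℂ (Fin n → ℂ) (S.ρ w)) ∧
        Wℂ.PrecI S)
    (hD : ∀ (v : HeightOneSpectrum (𝓞 K)) (n : ℕ)
      (πv : SmoothIrrep (GL (Fin n) (v.adicCompletion K))),
      (IrrClass.mk πv).IsSupercuspidal → ∀ (s : ℂ)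
      (S : WeilDeligneRep (v.adicCompletion K) ℂ (Fin n → ℂ)) (hS : S.IsFrobSemisimple),
      Quotient.mk (frobSemisimpleWDSetoid (v.adicCompletion K) n) ⟨S, hS⟩ = (𝓛 v).recTwist s πv →
        S.IsIrreducible)
    (hWD : ∀ (K : Type) [Field K] [NumberField K] (n ℓ : ℕ) [Fact ℓ.Prime]
      (ρ : FramedGaloisRep K (PadicAlgCl ℓ) n) (v : HeightOneSpectrum (𝓞 K)),
      ((ℓ : ℕ) : 𝓞 K) ∉ v.asIdeal →
        ∃ W : WeilDeligneRep (v.adicCompletion K) (PadicAlgCl ℓ) (Fin n → PadicAlgCl ℓ),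
          IsWeilDeligneOfLadic (ρ.toLocal v).toWeilGroupHom W)
    {n : ℕ} (hcpt : isCompact_glFiniteIntegralLevel n K) (π' : CuspidalAutomorphicRepData n K hcpt)
    (hRA : π'.1.IsRegularAlgebraic) (ℓ : ℕ) [Fact ℓ.Prime] (ι : PadicAlgCl ℓ ≃+* ℂ)
    (r : FramedGaloisRep K (PadicAlgCl ℓ) n)
    (hr : r.toGaloisRep.IsSemisimple ∧
      ∀ (v : HeightOneSpectrum (𝓞 K)) (β : Multiset ℂ), π'.1.HasSatakeParamAt v β →
        ((ℓ : ℕ) : 𝓞 K) ∉ v.asIdeal →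
          r.IsUnramifiedAt v ∧ r.HasFrobCharpolyAt v (arithFrobPolyOfSatake ι v.residueCard n β))
    (hv : ∃ (v : HeightOneSpectrum (𝓞 K)), ((ℓ : ℕ) : 𝓞 K) ∉ v.asIdeal ∧
      ∃ πv : SmoothIrrep (GL (Fin n) (v.adicCompletion K)),
        π'.1.HasLocalComponentAt v πv.ρ ∧ (IrrClass.mk πv).IsSupercuspidal) :
    r.toGaloisRep.IsIrreducible := by
  obtain ⟨v, hvℓ, πv, hπv, hsc⟩ := hv
  -- `W = WD(r|_{Γ_{K_v}})` (GD) and its transport `Wℂ = ι(W)`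
  obtain ⟨W, hW⟩ := hWD K n ℓ r v hvℓ
  obtain ⟨Wℂ, hWℂ⟩ :=
    Summit.Langlands.Langlands.Theorems.ReciprocityUpToIrreducibility.exists_isTransportAlong
      (ι : PadicAlgCl ℓ →+* ℂ) W
  -- a Frobenius-semisimple representative `S` of `rec_v(π'_v ⊗ |det|^{(1-n)/2})`
  obtain ⟨⟨S, hS⟩, hSq⟩ := Quotient.exists_rep ((𝓛 v).recTwist ((1 - (n : ℂ)) / 2) πv)
  have hcompat : HarrisLanTaylorThorne2016.IsCompatible π'.1 ι r :=
    HarrisLanTaylorThorne2016.isCompatible_of_forall_not_mem fun v hv α hα => hr.2 v α hα hv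
  -- (V): equal traces; (D): `S` irreducible
  have htr := (hV hcpt π' hRA ℓ ι r hr.1 hcompat v hvℓ πv hπv W Wℂ hW hWℂ S hS hSq).1
  have hSirr : S.IsIrreducible := hD v n πv hsc _ S hS hSq
  -- L2 ⇒ L3 ⇒ A1-irr
  have hWℂirr : Wℂ.IsIrreducible := isIrreducible_of_trace_eq S Wℂ hSirr htr
  have hWirr : W.IsIrreducible :=
    isIrreducible_of_isTransportAlong (ι : PadicAlgCl ℓ →+* ℂ) W Wℂ hWℂ hWℂirr
  exact isIrreducible_of_weilDeligne_isIrreducible r v W hW hWirr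

end Summit.Langlands.Langlands.Theorems.IrreducibleOffSector.SquareIntegrablePlace

end
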